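import Mathlib.Data.Matrix.Mul
import Mathlib.LinearAlgebra.Matrix.RowCol
import Mathlib.LinearAlgebra.Matrix.SchurComplement
import Mathlib.Analysis.Real.Sqrt
import Mathlib.Analysis.SpecialFunctions.Exp
import Mathlib.Analysis.Complex.Exponential
import Mathlib.Tactic.FieldSimp
import Mathlib.Tactic.Linarith
import Mathlib.Tactic.LinearCombination
import Mathlib.Tactic.Positivity
import HarnessLib

/-!
# The ellipsoid method: the central-cut update, containment of the kept half-ellipsoid,
# the volume-reduction factor and the stopping / infeasibility criteria (Antoniou–Lu, §13.6)

[cite: AntoniouLu2007, §13.6.1 (13.75)-(13.78), Algorithm 13.7; §13.6.2 (13.79)-(13.82),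
Algorithm 13.8; Problem 13.14]

A. Antoniou, W.-S. Lu, *Practical Optimization: Algorithms and Engineering Applications*,
Springer 2007, §13.6 "Ellipsoid Methods" (the method of Shor and Nemirovski–Yudin used by
Khachiyan, the book's reference [13], to prove polynomial-time solvability of LP; see also
[GrotschelLovaszSchrijver1981]).  Held copy read: `book:antoniou2007-practical-optimization`,
pp. 329–334 and Problem 13.14 (p. 337).

Setting of §13.6.1.  The current ellipsoid is
`E_k = {x : (x − x_k)ᵀA_k⁻¹(x − x_k) ≤ 1}` with `A_k` symmetric positive definite; `g_k` is a
subgradient of the convex objective at the centre `x_k`, normalised as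
`g̃_k = g_k/(g_kᵀA_kg_k)^{1/2}` (13.76c), so that `g̃_kᵀA_kg̃_k = 1`; the kept half is
`E_kh = E_k ∩ {x : g_kᵀ(x − x_k) ≤ 0}` and the update is
`x_{k+1} = x_k − A_kg̃_k/(n+1)` (13.76a), `A_{k+1} = n²/(n²−1)·(A_k − (2/(n+1))A_kg̃_kg̃_kᵀA_k)`
(13.76b).  We write `P = A_k⁻¹` (hypothesis `P * A = 1`), keep the inverse of the new matrix
EXPLICIT as `P_{k+1} = (n²−1)/n²·(P + (2/(n−1)) g̃_kg̃_kᵀ)` and certify `A_{k+1}P_{k+1} = I`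
(`update_mul_invUpdate`), so that membership in `E_{k+1}` is the literal quadratic inequality of
the book with `A_{k+1}⁻¹ = P_{k+1}`.  For `A` symmetric, `A_kg̃g̃ᵀA_k = (A_kg̃)(A_kg̃)ᵀ`, which is
how (13.76b) is written below (`vecMulVec (A *ᵥ g) (A *ᵥ g)`).  The dimension enters the update
only through the real parameter `N = n`; the algebraic facts hold for every real `N > 1` and are
stated that way, the volume statements for `N = n = Fintype.card`.

What is proved (no `sorry`, definition-free):
* `minimizer_in_kept_half` — (13.75) ⇒ the minimiser satisfies the cut `g_kᵀ(x⋆ − x_k) ≤ 0`;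
  `feasible_in_kept_half` — (13.80) ⇒ in a constraint iteration every feasible point satisfies
  `h_kᵀ(x − x_k) < 0` ("one of which is a region where every point is nonfeasible").
* `half_ellipsoid_subset` — **`E_kh ⊆ E_{k+1}`**: every `x` with `(x − x_k)ᵀP(x − x_k) ≤ 1` and
  `g̃ᵀ(x − x_k) ≤ 0` satisfies `(x − x_{k+1})ᵀP_{k+1}(x − x_{k+1}) ≤ 1` (the content of (13.76));
  `update_mul_invUpdate` — `A_{k+1}P_{k+1} = I` (Sherman–Morrison for (13.76b));
  `update_form_lower_bound` — `vᵀA_{k+1}v ≥ (N²/(N+1)²)·vᵀA_kv`, so `A_{k+1}` is again positive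
  definite ("`A_k` is a symmetric and positive-definite matrix" is maintained).
* `det_update` — `det A_{k+1} = (N²/(N²−1))ⁿ·(N−1)/(N+1)·det A_k` (matrix determinant lemma);
  `det_ratio_eq` — for `N = n ≥ 2` this factor is `(n/(n+1))^{n+1}(n/(n−1))^{n−1}`, the square of
  the volume ratio in (13.77) (`vol(E) = β_n √det A`);
  `volume_factor_lt_exp`, `volume_ratio_lt_exp` — **(13.77)**:
  `(n/(n+1))^{(n+1)/2}(n/(n−1))^{(n−1)/2} < e^{−1/(2n)}` for every `n ≥ 2`
  (proved from `Real.exp_bound'` and a third-order Bernoulli inequality);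
  `volume_after_steps` — hence `vol(E_k) < e^{−k/(2n)} vol(E_0)` for `k ≥ 1`.
* `linear_max_on_ellipsoid_le`, `linear_max_on_ellipsoid_attained` — **(13.78)** / Problem 13.14:
  `max_{x ∈ E_k} [−gᵀ(x − x_k)] = (gᵀA_kg)^{1/2}`, attained at `x = x_k − A_kg/(gᵀA_kg)^{1/2}`;
  `suboptimality_le` — the stopping criterion `f(x_k) − f(x⋆) ≤ (g_kᵀA_kg_k)^{1/2} = γ_k`
  (Algorithm 13.7, Steps 2–3); `infeasible_of_criterion` — **(13.82)**: if
  `c_{j*}(x_k) + (h_kᵀA_kh_k)^{1/2} < 0` then `c_{j*} < 0` on all of `E_k` (Algorithm 13.8, Step 3).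

Not formalised: that (13.76) is the ellipsoid of MINIMUM volume containing `E_kh` (only that it
contains `E_kh` and has the stated volume), the formula `vol(E_k) = β_n√det A_k` itself, and the
numerical Examples 13.6–13.7.  Related material in the tree, by name only (not imported, not
restated): the ellipsoid method is cited as an INPUT in `Literature.Barriers.PneNP.TardosFunction`
/ `MonotoneGapProofs` (Grötschel–Lovász–Schrijver) and is the algorithm NOT used in
`Literature.Combinatorics.SimpleGraph.LovaszThetaFWAlgorithm`; no statement about it existed.
-/

namespace Literature.Analysis.Convex.EllipsoidMethod

open Matrix Finset

variable {n : Type*} [Fintype n] [DecidableEq n]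

/-! ## Two private pieces of algebra -/

omit [DecidableEq n] in
/-- Expansion of the quadratic form of a symmetric matrix along `y + c b`. [folklore] -/
@[folklore] private theorem form_add_smul {P : Matrix n n ℝ} (hP : Pᵀ = P) (y b : n → ℝ)
    (c : ℝ) : (y + c • b) ⬝ᵥ (P *ᵥ (y + c • b))
      = y ⬝ᵥ (P *ᵥ y) + 2 * c * (b ⬝ᵥ (P *ᵥ y)) + c ^ 2 * (b ⬝ᵥ (P *ᵥ b)) := by
  have hsym : y ⬝ᵥ (P *ᵥ b) = b ⬝ᵥ (P *ᵥ y) := by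
    rw [dotProduct_mulVec, ← mulVec_transpose, hP, dotProduct_comm]
  rw [mulVec_add, mulVec_smul, dotProduct_add, add_dotProduct, add_dotProduct, smul_dotProduct,
    smul_dotProduct, dotProduct_smul, dotProduct_smul, hsym]
  simp only [smul_eq_mul]
  ring

omit [DecidableEq n] in
/-- Cauchy–Schwarz for the nonnegative quadratic form of a symmetric `P`, against a vector `b`
of positive `P`-length. [folklore] -/
@[folklore] private theorem form_cauchy_schwarz {P : Matrix n n ℝ} (hP : Pᵀ = P)
    (h0 : ∀ v, 0 ≤ v ⬝ᵥ (P *ᵥ v)) (y b : n → ℝ) {γ : ℝ} (hγ : 0 < γ)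
    (hb : b ⬝ᵥ (P *ᵥ b) = γ) :
    (b ⬝ᵥ (P *ᵥ y)) ^ 2 ≤ γ * (y ⬝ᵥ (P *ᵥ y)) := by
  have h := h0 (y + (-(b ⬝ᵥ (P *ᵥ y) / γ)) • b)
  rw [form_add_smul hP, hb] at h
  have e : y ⬝ᵥ (P *ᵥ y) + 2 * (-(b ⬝ᵥ (P *ᵥ y) / γ)) * (b ⬝ᵥ (P *ᵥ y))
      + (-(b ⬝ᵥ (P *ᵥ y) / γ)) ^ 2 * γ = (γ * (y ⬝ᵥ (P *ᵥ y)) - (b ⬝ᵥ (P *ᵥ y)) ^ 2) / γ := by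
    field_simp
    ring
  rw [e] at h
  have := (div_nonneg_iff.mp h)
  rcases this with ⟨h1, _⟩ | ⟨_, h2⟩
  · linarith
  · exact absurd h2 (not_le.mpr hγ)

/-! ## The cuts (13.75), (13.80) -/

omit [Fintype n] [DecidableEq n] in
/-- (13.75) ⇒ the kept half contains the minimiser: if `f(x⋆) ≥ f(x_k) + g_kᵀ(x⋆ − x_k)`
(subgradient inequality) and `f(x⋆) ≤ f(x_k)`, then `g_kᵀ(x⋆ − x_k) ≤ 0`, i.e. `x⋆ ∈ E_kh`
whenever `x⋆ ∈ E_k`. [cite: AntoniouLu2007, §13.6.1 (13.75)] -/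
theorem minimizer_in_kept_half {f : (n → ℝ) → ℝ} {xk xstar : n → ℝ} {t : ℝ}
    (hsub : f xk + t ≤ f xstar) (hmin : f xstar ≤ f xk) : t ≤ 0 := by
  linarith

omit [Fintype n] [DecidableEq n] in
/-- (13.80) ⇒ in a constraint iteration (`c_{j*}(x_k) < 0`, `h_k` a subgradient of `−c_{j*}` at
`x_k`, so `−c_{j*}(x) ≥ −c_{j*}(x_k) + h_kᵀ(x − x_k)`) every FEASIBLE point `x` (`c_{j*}(x) ≥ 0`)
has `h_kᵀ(x − x_k) < 0`: "at any point `x` with `h_kᵀ(x − x_k) ≥ 0`, we have `c_{j*}(x) < 0`".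
[cite: AntoniouLu2007, §13.6.2 (13.80)] -/
theorem feasible_in_kept_half {c : (n → ℝ) → ℝ} {xk x : n → ℝ} {t : ℝ}
    (hsub : -c xk + t ≤ -c x) (hk : c xk < 0) (hx : 0 ≤ c x) : t < 0 := by
  linarith

/-! ## The update (13.76): containment, inverse, definiteness -/

/-- **The new ellipsoid contains the kept half-ellipsoid** (the content of (13.76)).  Let
`P = A_k⁻¹` (`P A_k = I`, `P` symmetric with nonnegative form), `g̃` normalised by
`g̃ᵀA_kg̃ = 1` (13.76c), `N > 1`, `x_{k+1} = x_k − A_kg̃/(N+1)` (13.76a) and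
`P_{k+1} = (N²−1)/N²·(P + (2/(N−1)) g̃g̃ᵀ)` — the inverse of `A_{k+1}` of (13.76b), see
`update_mul_invUpdate`.  Then every `x ∈ E_kh`, i.e. `(x − x_k)ᵀP(x − x_k) ≤ 1` and
`g̃ᵀ(x − x_k) ≤ 0`, satisfies `(x − x_{k+1})ᵀP_{k+1}(x − x_{k+1}) ≤ 1`, i.e. `x ∈ E_{k+1}`.
(Proof: with `q = (x−x_k)ᵀP(x−x_k) ≤ 1` and `t = g̃ᵀ(x − x_k) ∈ [−1, 0]` the left side equals
`((N²−1)q + 2(N+1)t(t+1) + 1)/N²`.) [cite: AntoniouLu2007, §13.6.1 (13.76a)-(13.76c)] -/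
theorem half_ellipsoid_subset {A P : Matrix n n ℝ} (hPA : P * A = 1) (hP : Pᵀ = P)
    (h0 : ∀ v, 0 ≤ v ⬝ᵥ (P *ᵥ v)) {g : n → ℝ} (hg : g ⬝ᵥ (A *ᵥ g) = 1) {N : ℝ} (hN : 1 < N)
    {xk x : n → ℝ} (hmem : (x - xk) ⬝ᵥ (P *ᵥ (x - xk)) ≤ 1) (hcut : g ⬝ᵥ (x - xk) ≤ 0) :
    (x - (xk - (1 / (N + 1)) • (A *ᵥ g))) ⬝ᵥ
        ((((N ^ 2 - 1) / N ^ 2) • (P + (2 / (N - 1)) • vecMulVec g g)) *ᵥ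
          (x - (xk - (1 / (N + 1)) • (A *ᵥ g)))) ≤ 1 := by
  have hPb : P *ᵥ (A *ᵥ g) = g := by rw [mulVec_mulVec, hPA, one_mulVec]
  have hbPy : (A *ᵥ g) ⬝ᵥ (P *ᵥ (x - xk)) = g ⬝ᵥ (x - xk) := by
    rw [dotProduct_mulVec, ← mulVec_transpose, hP, hPb]
  have hbPb : (A *ᵥ g) ⬝ᵥ (P *ᵥ (A *ᵥ g)) = 1 := by rw [hPb, dotProduct_comm, hg]
  -- abbreviations
  set q := (x - xk) ⬝ᵥ (P *ᵥ (x - xk)) with hq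
  set t := g ⬝ᵥ (x - xk) with ht
  have ht1 : -1 ≤ t := by
    have hcs := form_cauchy_schwarz hP h0 (x - xk) (A *ᵥ g) one_pos hbPb
    rw [hbPy, one_mul] at hcs
    nlinarith
  have hw : x - (xk - (1 / (N + 1)) • (A *ᵥ g)) = (x - xk) + (1 / (N + 1)) • (A *ᵥ g) := by
    abel
  have hgw : g ⬝ᵥ ((x - xk) + (1 / (N + 1)) • (A *ᵥ g)) = t + 1 / (N + 1) := by
    rw [dotProduct_add, dotProduct_smul, hg, smul_eq_mul, mul_one]
  have hform : ((x - xk) + (1 / (N + 1)) • (A *ᵥ g)) ⬝ᵥ (P *ᵥ ((x - xk) + (1 / (N + 1)) • (A *ᵥ g)))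
      = q + 2 * (1 / (N + 1)) * t + (1 / (N + 1)) ^ 2 := by
    rw [form_add_smul hP, hbPy, hbPb, mul_one]
  rw [hw, smul_mulVec, add_mulVec, dotProduct_smul, dotProduct_add, hform, smul_mulVec,
    dotProduct_smul, vecMulVec_mulVec, op_smul_eq_smul, dotProduct_smul, dotProduct_comm _ g, hgw,
    smul_eq_mul, smul_eq_mul, smul_eq_mul]
  have hN0 : N ≠ 0 := by positivity
  have hN1 : N + 1 ≠ 0 := by positivity
  have hN2 : N - 1 ≠ 0 := sub_ne_zero.mpr (ne_of_gt hN)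
  have key : (N ^ 2 - 1) / N ^ 2 * (q + 2 * (1 / (N + 1)) * t + (1 / (N + 1)) ^ 2
      + 2 / (N - 1) * ((t + 1 / (N + 1)) * (t + 1 / (N + 1))))
      = ((N ^ 2 - 1) * q + 2 * (N + 1) * (t * (t + 1)) + 1) / N ^ 2 := by
    field_simp
    ring
  rw [key, div_le_one (by positivity)]
  have hN3 : 0 ≤ N ^ 2 - 1 := by nlinarith
  have h1 : (N ^ 2 - 1) * q ≤ N ^ 2 - 1 := mul_le_of_le_one_right hN3 hmem
  have h2 : t * (t + 1) ≤ 0 := by nlinarith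
  nlinarith

/-- **`P_{k+1}` is the inverse of `A_{k+1}`** (Sherman–Morrison for the rank-one update (13.76b)):
with `P = A_k⁻¹` symmetric and `g̃ᵀA_kg̃ = 1`,
`[N²/(N²−1)·(A_k − (2/(N+1))(A_kg̃)(A_kg̃)ᵀ)] · [(N²−1)/N²·(P + (2/(N−1)) g̃g̃ᵀ)] = I`.
[cite: AntoniouLu2007, §13.6.1 (13.76b)] -/
theorem update_mul_invUpdate {A P : Matrix n n ℝ} (hPA : P * A = 1) (hP : Pᵀ = P)
    {g : n → ℝ} (hg : g ⬝ᵥ (A *ᵥ g) = 1) {N : ℝ} (hN : 1 < N) :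
    ((N ^ 2 / (N ^ 2 - 1)) • (A - (2 / (N + 1)) • vecMulVec (A *ᵥ g) (A *ᵥ g)))
      * (((N ^ 2 - 1) / N ^ 2) • (P + (2 / (N - 1)) • vecMulVec g g)) = 1 := by
  have hAP : A * P = 1 := mul_eq_one_comm.mp hPA
  have hPb : P *ᵥ (A *ᵥ g) = g := by rw [mulVec_mulVec, hPA, one_mulVec]
  have hbP : (A *ᵥ g) ᵥ* P = g := by rw [← mulVec_transpose, hP, hPb]
  have hbg : (A *ᵥ g) ⬝ᵥ g = 1 := by rw [dotProduct_comm, hg]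
  have hN0 : N ≠ 0 := by positivity
  have hN1 : N + 1 ≠ 0 := by positivity
  have hN2 : N - 1 ≠ 0 := sub_ne_zero.mpr (ne_of_gt hN)
  have hN3 : N ^ 2 - 1 ≠ 0 := by
    have : N ^ 2 - 1 = (N - 1) * (N + 1) := by ring
    rw [this]; exact mul_ne_zero hN2 hN1
  have hXY : (A - (2 / (N + 1)) • vecMulVec (A *ᵥ g) (A *ᵥ g))
      * (P + (2 / (N - 1)) • vecMulVec g g) = 1 := by
    rw [Matrix.sub_mul, Matrix.mul_add, Matrix.mul_add, hAP, Matrix.mul_smul, mul_vecMulVec,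
      Matrix.smul_mul, Matrix.smul_mul, vecMulVec_mul, hbP, Matrix.mul_smul,
      vecMulVec_mul_vecMulVec, hbg, one_smul]
    have hcoef : 2 / (N - 1) - 2 / (N + 1) - 2 / (N + 1) * (2 / (N - 1)) = 0 := by
      field_simp
      ring
    ext i j
    simp only [Matrix.add_apply, Matrix.sub_apply, Matrix.smul_apply, smul_eq_mul]
    linear_combination (vecMulVec (A *ᵥ g) g i j) * hcoef
  rw [Matrix.smul_mul, Matrix.mul_smul, smul_smul, hXY]
  have : N ^ 2 / (N ^ 2 - 1) * ((N ^ 2 - 1) / N ^ 2) = 1 := by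
    field_simp
  rw [this, one_smul]

omit [DecidableEq n] in
/-- **`A_{k+1}` stays positive definite**: for `A_k` symmetric with nonnegative form and
`g̃ᵀA_kg̃ = 1`, `vᵀA_{k+1}v ≥ (N²/(N+1)²)·vᵀA_kv` for every `v` (Cauchy–Schwarz
`((A_kg̃)ᵀv)² ≤ vᵀA_kv`), so the hypothesis "`A_k` is a symmetric and positive-definite matrix"
propagates along Algorithm 13.7. [cite: AntoniouLu2007, §13.6.1 (13.76b), Algorithm 13.7 Step 4] -/
theorem update_form_lower_bound {A : Matrix n n ℝ} (hA : Aᵀ = A) (h0 : ∀ v, 0 ≤ v ⬝ᵥ (A *ᵥ v))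
    {g : n → ℝ} (hg : g ⬝ᵥ (A *ᵥ g) = 1) {N : ℝ} (hN : 1 < N) (v : n → ℝ) :
    N ^ 2 / (N + 1) ^ 2 * (v ⬝ᵥ (A *ᵥ v))
      ≤ v ⬝ᵥ (((N ^ 2 / (N ^ 2 - 1)) • (A - (2 / (N + 1)) • vecMulVec (A *ᵥ g) (A *ᵥ g))) *ᵥ v) := by
  have hcs := form_cauchy_schwarz hA h0 v g one_pos hg
  have hbv : (A *ᵥ g) ⬝ᵥ v = g ⬝ᵥ (A *ᵥ v) := by
    rw [dotProduct_mulVec, ← mulVec_transpose, hA, dotProduct_comm]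
  rw [smul_mulVec, dotProduct_smul, sub_mulVec, smul_mulVec, dotProduct_sub,
    dotProduct_smul, vecMulVec_mulVec, op_smul_eq_smul, dotProduct_smul, dotProduct_comm v (A *ᵥ g),
    hbv, smul_eq_mul, smul_eq_mul, smul_eq_mul]
  have hN1 : (0 : ℝ) < N + 1 := by linarith
  have hN2 : (0 : ℝ) < N - 1 := by linarith
  have hN3 : 0 < N ^ 2 - 1 := by nlinarith
  rw [one_mul] at hcs
  have key : N ^ 2 / (N ^ 2 - 1) * (v ⬝ᵥ (A *ᵥ v) - 2 / (N + 1) * (v ⬝ᵥ (A *ᵥ v)))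
      = N ^ 2 / (N + 1) ^ 2 * (v ⬝ᵥ (A *ᵥ v)) := by
    field_simp
    ring
  have hmono : N ^ 2 / (N ^ 2 - 1) * (v ⬝ᵥ (A *ᵥ v) - 2 / (N + 1) * (v ⬝ᵥ (A *ᵥ v)))
      ≤ N ^ 2 / (N ^ 2 - 1) * (v ⬝ᵥ (A *ᵥ v) - 2 / (N + 1) * ((g ⬝ᵥ (A *ᵥ v)) * (g ⬝ᵥ (A *ᵥ v)))) := by
    apply mul_le_mul_of_nonneg_left _ (by positivity)
    apply sub_le_sub_left
    apply mul_le_mul_of_nonneg_left _ (by positivity)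
    nlinarith
  linarith [key]

/-! ## Volume reduction (13.77) -/

/-- **Determinant of the update** (matrix determinant lemma): with `g̃ᵀA_kg̃ = 1`,
`det A_{k+1} = (N²/(N²−1))^{n}·(N−1)/(N+1)·det A_k` where `n = Fintype.card` is the dimension
(since `A_k − c(A_kg̃)(A_kg̃)ᵀ = A_k(I − c g̃(A_kg̃)ᵀ)` and `det(I − c g̃(A_kg̃)ᵀ) = 1 − c`).
With `vol(E) = β_n√det A` this is the square of the volume ratio in (13.77).
[cite: AntoniouLu2007, §13.6.1 (13.76b), (13.77)] -/
theorem det_update {A : Matrix n n ℝ} {g : n → ℝ} (hg : g ⬝ᵥ (A *ᵥ g) = 1) {N : ℝ}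
    (hN : 1 < N) :
    ((N ^ 2 / (N ^ 2 - 1)) • (A - (2 / (N + 1)) • vecMulVec (A *ᵥ g) (A *ᵥ g))).det
      = (N ^ 2 / (N ^ 2 - 1)) ^ Fintype.card n * ((N - 1) / (N + 1)) * A.det := by
  have hN1 : N + 1 ≠ 0 := by positivity
  have h1 : A - (2 / (N + 1)) • vecMulVec (A *ᵥ g) (A *ᵥ g)
      = A * (1 - (2 / (N + 1)) • vecMulVec g (A *ᵥ g)) := by
    rw [Matrix.mul_sub, Matrix.mul_one, Matrix.mul_smul, mul_vecMulVec]
  have h2 : (1 - (2 / (N + 1)) • vecMulVec g (A *ᵥ g) : Matrix n n ℝ).det = 1 - 2 / (N + 1) := by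
    have : (1 - (2 / (N + 1)) • vecMulVec g (A *ᵥ g) : Matrix n n ℝ)
        = 1 + replicateCol Unit (-((2 / (N + 1)) • g)) * replicateRow Unit (A *ᵥ g) := by
      rw [← vecMulVec_eq, neg_vecMulVec, smul_vecMulVec, sub_eq_add_neg]
    rw [this, det_one_add_replicateCol_mul_replicateRow, dotProduct_neg, dotProduct_smul,
      dotProduct_comm, hg, smul_eq_mul, mul_one, sub_eq_add_neg]
  rw [det_smul, h1, det_mul, h2]
  field_simp
  ring

/-- The determinant factor at `N = n` (the dimension), `n ≥ 2`:
`(n²/(n²−1))ⁿ·(n−1)/(n+1) = (n/(n+1))^{n+1}(n/(n−1))^{n−1}` — the square of the factor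
`(n/(n+1))^{(n+1)/2}(n/(n−1))^{(n−1)/2}` of (13.77). [cite: AntoniouLu2007, §13.6.1 (13.77)] -/
theorem det_ratio_eq {m : ℕ} (hm : 2 ≤ m) :
    ((m : ℝ) ^ 2 / ((m : ℝ) ^ 2 - 1)) ^ m * (((m : ℝ) - 1) / ((m : ℝ) + 1))
      = ((m : ℝ) / (m + 1)) ^ (m + 1) * ((m : ℝ) / (m - 1)) ^ (m - 1) := by
  obtain ⟨k, rfl⟩ : ∃ k, m = k + 2 := ⟨m - 2, by omega⟩
  have e1 : k + 2 - 1 = k + 1 := by omega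
  rw [e1]
  push_cast
  have hk1 : (k : ℝ) + 2 - 1 = k + 1 := by ring
  have hk2 : ((k : ℝ) + 2) ^ 2 - 1 = (k + 1) * (k + 3) := by ring
  have hk3 : (k : ℝ) + 2 + 1 = k + 3 := by ring
  rw [hk1, hk2, hk3]
  have ha : (k : ℝ) + 1 ≠ 0 := by positivity
  have hb : (k : ℝ) + 3 ≠ 0 := by positivity
  rw [div_pow, div_pow, div_pow, mul_pow, ← pow_mul]
  field_simp
  ring

/-- Third-order Bernoulli lower bound: for `v ≤ 1` and every natural `k`,
`(1 − v)^k ≥ 1 − kv + k(k−1)/2·v² − k(k−1)(k−2)/6·v³`. [folklore] -/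
@[folklore] private theorem bernoulli_three (k : ℕ) {v : ℝ} (hv1 : v ≤ 1) :
    1 - k * v + k * (k - 1) / 2 * v ^ 2 - k * (k - 1) * (k - 2) / 6 * v ^ 3 ≤ (1 - v) ^ k := by
  induction k with
  | zero => simp
  | succ k ih =>
    have hk3 : 0 ≤ (k : ℝ) * (k - 1) * (k - 2) := by
      rcases Nat.lt_or_ge k 3 with h | h
      · rcases (show k = 0 ∨ k = 1 ∨ k = 2 by omega) with rfl | rfl | rfl <;> norm_num
      · have : (3 : ℝ) ≤ k := by exact_mod_cast h
        have h1 : (0 : ℝ) ≤ k - 1 := by linarith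
        have h2 : (0 : ℝ) ≤ k - 2 := by linarith
        exact mul_nonneg (mul_nonneg (by positivity) h1) h2
    have step := mul_le_mul_of_nonneg_right ih (sub_nonneg.mpr hv1)
    have hv4 : 0 ≤ v ^ 4 := by positivity
    have e : (1 - ((k : ℝ) + 1) * v + ((k : ℝ) + 1) * ((k : ℝ) + 1 - 1) / 2 * v ^ 2
        - ((k : ℝ) + 1) * ((k : ℝ) + 1 - 1) * ((k : ℝ) + 1 - 2) / 6 * v ^ 3)
        = (1 - k * v + k * (k - 1) / 2 * v ^ 2 - k * (k - 1) * (k - 2) / 6 * v ^ 3) * (1 - v)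
          - k * (k - 1) * (k - 2) / 6 * v ^ 4 := by
      ring
    push_cast
    rw [e, pow_succ (1 - v) k]
    nlinarith [mul_nonneg hk3 hv4, step]

/-- **The volume-reduction factor (13.77), squared form**: for every dimension `n ≥ 2`,
`(n/(n+1))^{n+1}·(n/(n−1))^{n−1} < e^{−1/n}`.  (Proof: with `y = 1/n`,
`e^{y} ≤ 1 + y + y²/2 + y³/6 + 5y⁴/96` (`Real.exp_bound'`) is strictly below
`(1+y)²(1−y²)^{n−1}`, bounded from below by the third-order Bernoulli inequality; the difference
of the two polynomials is `y³/6 + 11y⁴/96 + y⁵/2 − 2y⁶/3 + y⁷/6 + y⁸ > 0` on `(0, 1/2]`.)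
[cite: AntoniouLu2007, §13.6.1 (13.77)] -/
theorem volume_factor_lt_exp {m : ℕ} (hm : 2 ≤ m) :
    ((m : ℝ) / (m + 1)) ^ (m + 1) * ((m : ℝ) / (m - 1)) ^ (m - 1) < Real.exp (-(1 / (m : ℝ))) := by
  obtain ⟨k, rfl⟩ : ∃ k, m = k + 1 := ⟨m - 1, by omega⟩
  have hk1 : (1 : ℝ) ≤ k := by exact_mod_cast (show 1 ≤ k by omega)
  rw [Nat.add_sub_cancel]
  push_cast
  set M : ℝ := (k : ℝ) + 1 with hM
  have hM0 : 0 < M := by positivity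
  have hM2 : 2 ≤ M := by linarith
  set y : ℝ := 1 / M with hy
  have hy0 : 0 < y := by positivity
  have hy1 : y ≤ 1 / 2 := one_div_le_one_div_of_le two_pos hM2
  have hMy : M * y = 1 := by rw [hy]; field_simp
  -- (1) the exponential is below its quartic Taylor bound
  have hexp : Real.exp y ≤ 1 + y + y ^ 2 / 2 + y ^ 3 / 6 + 5 * y ^ 4 / 96 := by
    have h := Real.exp_bound' hy0.le (by linarith) (n := 4) (by norm_num)
    have e : (∑ i ∈ Finset.range 4, y ^ i / (i.factorial : ℝ)) + y ^ 4 * (4 + 1) / ((4 : ℕ).factorial * 4)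
        = 1 + y + y ^ 2 / 2 + y ^ 3 / 6 + 5 * y ^ 4 / 96 := by
      simp [Finset.sum_range_succ, Nat.factorial]
      ring
    linarith [e ▸ h]
  -- (2) Bernoulli for (1 − y²)^(k) with k = M − 1, rewritten through M y = 1
  have hB := bernoulli_three k (v := y ^ 2) (by nlinarith)
  have hkM : (k : ℝ) = M - 1 := by rw [hM]; ring
  rw [hkM] at hB
  have hBy : 1 - (M - 1) * y ^ 2 + (M - 1) * (M - 1 - 1) / 2 * (y ^ 2) ^ 2
      - (M - 1) * (M - 1 - 1) * (M - 1 - 2) / 6 * (y ^ 2) ^ 3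
      = 1 - y + y ^ 2 + (1 - y) * (1 - 2 * y) * y ^ 2 / 2
        - (1 - y) * (1 - 2 * y) * (1 - 3 * y) * y ^ 3 / 6 := by
    have hM' : M = 1 / y := by rw [hy]; field_simp
    rw [hM']
    field_simp
    ring
  rw [hBy] at hB
  -- (3) the polynomial gap
  have hgap : 1 + y + y ^ 2 / 2 + y ^ 3 / 6 + 5 * y ^ 4 / 96
      < (1 + y) ^ 2 * (1 - y + y ^ 2 + (1 - y) * (1 - 2 * y) * y ^ 2 / 2
        - (1 - y) * (1 - 2 * y) * (1 - 3 * y) * y ^ 3 / 6) := by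
    have h5 : 0 ≤ y ^ 5 * (1 / 2 - 2 * y / 3) := mul_nonneg (by positivity) (by linarith)
    nlinarith [pow_pos hy0 3, pow_pos hy0 4, pow_pos hy0 7, pow_pos hy0 8, h5]
  -- (4) assemble: e^y < (1+y)² (1−y²)^k = (M+1)^(k+2) (M−1)^k / M^(2k+2)
  have hpos2 : 0 < (1 + y) ^ 2 := by positivity
  have hchain : Real.exp y < (1 + y) ^ 2 * (1 - y ^ 2) ^ k := by
    calc Real.exp y ≤ _ := hexp
      _ < _ := hgap
      _ ≤ (1 + y) ^ 2 * (1 - y ^ 2) ^ k := mul_le_mul_of_nonneg_left hB hpos2.le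
  have hR : (1 + y) ^ 2 * (1 - y ^ 2) ^ k = ((M + 1) / M) ^ (k + 1 + 1) * ((M - 1) / M) ^ k := by
    have e1 : 1 + y = (M + 1) / M := by rw [hy]; field_simp
    have e2 : 1 - y ^ 2 = ((M - 1) / M) * ((M + 1) / M) := by rw [hy]; field_simp; ring
    rw [e1, e2, mul_pow]
    ring
  rw [hR] at hchain
  have hRpos : 0 < ((M + 1) / M) ^ (k + 1 + 1) * ((M - 1) / M) ^ k := by
    have : 0 < (M - 1) / M := by apply div_pos <;> linarith
    positivity
  have hinv : (M / (M + 1)) ^ (k + 1 + 1) * (M / (M - 1)) ^ k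
      = (((M + 1) / M) ^ (k + 1 + 1) * ((M - 1) / M) ^ k)⁻¹ := by
    rw [mul_inv, ← inv_pow, ← inv_pow, inv_div, inv_div]
  rw [hinv, show -(1 / M) = -y by rw [hy], Real.exp_neg]
  exact (inv_lt_inv₀ hRpos (Real.exp_pos y)).mpr hchain

/-- **(13.77)**: the volume ratio `vol(E_{k+1})/vol(E_k) = (n/(n+1))^{(n+1)/2}(n/(n−1))^{(n−1)/2}`
is `< e^{−1/(2n)}` for every `n ≥ 2` ("the volume-reduction rate depends only on the dimension";
for `n = 2` it is `0.7698`). [cite: AntoniouLu2007, §13.6.1 (13.77)] -/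
theorem volume_ratio_lt_exp {m : ℕ} (hm : 2 ≤ m) :
    Real.sqrt (((m : ℝ) / (m + 1)) ^ (m + 1) * ((m : ℝ) / (m - 1)) ^ (m - 1))
      < Real.exp (-(1 / (2 * (m : ℝ)))) := by
  have h := volume_factor_lt_exp hm
  have hm1 : (0 : ℝ) ≤ (m : ℝ) - 1 := by
    have : (2 : ℝ) ≤ m := by exact_mod_cast hm
    linarith
  have h0 : 0 ≤ ((m : ℝ) / (m + 1)) ^ (m + 1) * ((m : ℝ) / (m - 1)) ^ (m - 1) := by positivity
  calc Real.sqrt _ < Real.sqrt (Real.exp (-(1 / (m : ℝ)))) := Real.sqrt_lt_sqrt h0 h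
    _ = Real.exp (-(1 / (2 * (m : ℝ)))) := by
        rw [← Real.exp_half]
        congr 1
        ring

/-- **`vol(E_k) < e^{−k/(2n)} vol(E_0)`** ("and hence `vol(E_k)` approaches zero as `k → ∞`"):
if a positive sequence satisfies `v_{k+1} = r·v_k` with `0 ≤ r < e^{−c}` (here
`r = (n/(n+1))^{(n+1)/2}(n/(n−1))^{(n−1)/2}`, `c = 1/(2n)`, by `volume_ratio_lt_exp`), then
`v_k < e^{−kc}·v_0` for all `k ≥ 1`. [cite: AntoniouLu2007, §13.6.1 (13.77)] -/
theorem volume_after_steps (v : ℕ → ℝ) {r c : ℝ} (hv0 : 0 < v 0) (hr : 0 ≤ r)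
    (hrc : r < Real.exp (-c)) (hstep : ∀ k, v (k + 1) = r * v k) {k : ℕ} (hk : 1 ≤ k) :
    v k < Real.exp (-(k * c)) * v 0 := by
  have hvk : ∀ j, v j = r ^ j * v 0 := by
    intro j
    induction j with
    | zero => simp
    | succ j ih => rw [hstep, ih, pow_succ]; ring
  rw [hvk, show -((k : ℝ) * c) = k * (-c) by ring, Real.exp_nat_mul]
  exact mul_lt_mul_of_pos_right (pow_lt_pow_left₀ hrc hr (by omega)) hv0

/-! ## The stopping criterion (13.78) and the infeasibility criterion (13.82) -/

/-- **(13.78) / Problem 13.14, upper bound**: for `P = A⁻¹` (`P A = I`, `P` symmetric with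
nonnegative form), `gᵀAg > 0` and any `x ∈ E_k` (`(x − x_k)ᵀP(x − x_k) ≤ 1`):
`−gᵀ(x − x_k) ≤ (gᵀAg)^{1/2}`. [cite: AntoniouLu2007, §13.6.1 (13.78); Problem 13.14] -/
theorem linear_max_on_ellipsoid_le {A P : Matrix n n ℝ} (hPA : P * A = 1) (hP : Pᵀ = P)
    (h0 : ∀ v, 0 ≤ v ⬝ᵥ (P *ᵥ v)) {g : n → ℝ} (hγ : 0 < g ⬝ᵥ (A *ᵥ g)) {xk x : n → ℝ}
    (hmem : (x - xk) ⬝ᵥ (P *ᵥ (x - xk)) ≤ 1) :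
    -(g ⬝ᵥ (x - xk)) ≤ Real.sqrt (g ⬝ᵥ (A *ᵥ g)) := by
  have hPb : P *ᵥ (A *ᵥ g) = g := by rw [mulVec_mulVec, hPA, one_mulVec]
  have hbPy : (A *ᵥ g) ⬝ᵥ (P *ᵥ (x - xk)) = g ⬝ᵥ (x - xk) := by
    rw [dotProduct_mulVec, ← mulVec_transpose, hP, hPb]
  have hbPb : (A *ᵥ g) ⬝ᵥ (P *ᵥ (A *ᵥ g)) = g ⬝ᵥ (A *ᵥ g) := by rw [hPb, dotProduct_comm]
  have hcs := form_cauchy_schwarz hP h0 (x - xk) (A *ᵥ g) hγ hbPb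
  rw [hbPy] at hcs
  have hsq : (g ⬝ᵥ (x - xk)) ^ 2 ≤ g ⬝ᵥ (A *ᵥ g) := by nlinarith [h0 (x - xk)]
  calc -(g ⬝ᵥ (x - xk)) ≤ |g ⬝ᵥ (x - xk)| := neg_le_abs _
    _ ≤ Real.sqrt (g ⬝ᵥ (A *ᵥ g)) := Real.abs_le_sqrt hsq

/-- **(13.78) / Problem 13.14, attainment**: the bound is attained at
`x = x_k − Ag/(gᵀAg)^{1/2}`, which lies on the boundary of `E_k`.
[cite: AntoniouLu2007, §13.6.1 (13.78); Problem 13.14] -/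
theorem linear_max_on_ellipsoid_attained {A P : Matrix n n ℝ} (hPA : P * A = 1)
    {g : n → ℝ} (hγ : 0 < g ⬝ᵥ (A *ᵥ g)) (xk : n → ℝ) :
    ((xk - (1 / Real.sqrt (g ⬝ᵥ (A *ᵥ g))) • (A *ᵥ g)) - xk) ⬝ᵥ
        (P *ᵥ ((xk - (1 / Real.sqrt (g ⬝ᵥ (A *ᵥ g))) • (A *ᵥ g)) - xk)) = 1 ∧
      -(g ⬝ᵥ ((xk - (1 / Real.sqrt (g ⬝ᵥ (A *ᵥ g))) • (A *ᵥ g)) - xk))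
        = Real.sqrt (g ⬝ᵥ (A *ᵥ g)) := by
  have hPb : P *ᵥ (A *ᵥ g) = g := by rw [mulVec_mulVec, hPA, one_mulVec]
  have hbg : (A *ᵥ g) ⬝ᵥ g = g ⬝ᵥ (A *ᵥ g) := dotProduct_comm _ _
  have hs : 0 < Real.sqrt (g ⬝ᵥ (A *ᵥ g)) := Real.sqrt_pos.mpr hγ
  have hss : Real.sqrt (g ⬝ᵥ (A *ᵥ g)) ^ 2 = g ⬝ᵥ (A *ᵥ g) := Real.sq_sqrt hγ.le
  have hd : (xk - (1 / Real.sqrt (g ⬝ᵥ (A *ᵥ g))) • (A *ᵥ g)) - xk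
      = (-(1 / Real.sqrt (g ⬝ᵥ (A *ᵥ g)))) • (A *ᵥ g) := by
    rw [neg_smul]; abel
  rw [hd]
  constructor
  · rw [mulVec_smul, hPb, smul_dotProduct, dotProduct_smul, hbg, smul_eq_mul, smul_eq_mul]
    field_simp
    rw [hss]
  · rw [dotProduct_smul, smul_eq_mul]
    field_simp
    rw [hss]

/-- **Stopping criterion** (Algorithm 13.7, Steps 2–3): if `x⋆ ∈ E_k` and
`f(x⋆) ≥ f(x_k) + g_kᵀ(x⋆ − x_k)` (13.75), then `f(x_k) − f(x⋆) ≤ (g_kᵀA_kg_k)^{1/2} = γ_k`;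
"therefore, we can terminate the algorithm if `γ_k < ε`".
[cite: AntoniouLu2007, §13.6.1 (13.78), Algorithm 13.7] -/
theorem suboptimality_le {A P : Matrix n n ℝ} (hPA : P * A = 1) (hP : Pᵀ = P)
    (h0 : ∀ v, 0 ≤ v ⬝ᵥ (P *ᵥ v)) {g : n → ℝ} (hγ : 0 < g ⬝ᵥ (A *ᵥ g)) {xk xstar : n → ℝ}
    (hmem : (xstar - xk) ⬝ᵥ (P *ᵥ (xstar - xk)) ≤ 1) {fk fstar : ℝ}
    (hsub : fk + g ⬝ᵥ (xstar - xk) ≤ fstar) : fk - fstar ≤ Real.sqrt (g ⬝ᵥ (A *ᵥ g)) := by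
  have h := linear_max_on_ellipsoid_le hPA hP h0 hγ hmem
  linarith

/-- **Infeasibility criterion (13.82)** (Algorithm 13.8, Step 3): in a constraint iteration, if
`c_{j*}(x_k) + (h_kᵀA_kh_k)^{1/2} < 0` then `c_{j*}(x) < 0` for EVERY `x ∈ E_k` — "no feasible
points exist in `E_k` in such a case" (from (13.80) and (13.78) applied to `h_k`).
[cite: AntoniouLu2007, §13.6.2 (13.80), (13.82), Algorithm 13.8] -/
theorem infeasible_of_criterion {A P : Matrix n n ℝ} (hPA : P * A = 1) (hP : Pᵀ = P)
    (h0 : ∀ v, 0 ≤ v ⬝ᵥ (P *ᵥ v)) {h : n → ℝ} (hγ : 0 < h ⬝ᵥ (A *ᵥ h)) {xk x : n → ℝ}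
    (hmem : (x - xk) ⬝ᵥ (P *ᵥ (x - xk)) ≤ 1) {ck cx : ℝ}
    (hsub : -ck + h ⬝ᵥ (x - xk) ≤ -cx) (hcrit : ck + Real.sqrt (h ⬝ᵥ (A *ᵥ h)) < 0) :
    cx < 0 := by
  have hb := linear_max_on_ellipsoid_le hPA hP h0 hγ hmem
  linarith

end Literature.Analysis.Convex.EllipsoidMethod
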